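import Mathlib
import Summits.Ventures.FusionMHD.Models.TearingFRS1Jets
import Literature.Analysis.ODE.RegularSingularSharpRadius
import HarnessLib

/-!
# F3.r3 instance «TearingFRS1», step (3): sharp-radius bounds and the two local solutions on the patch
# `0 < |x| < 1/512`, both sides of the rational surface

Companion of `TearingFRS1.lean` / `TearingFRS1Coeffs.lean` / `TearingFRS1Jets.lean` (instance card
`models/F3-SCOPING.md` §7). From the exact jets: `small_coeff_bound : ‖sₙ‖ ≤ 64ⁿ` and
`reg_coeff_bound : ‖wₙ‖ ≤ (14/5)·512ⁿ` for ALL `n` by `norm_frobeniusCoeff_le_of_jet` (thresholds `10.71 ≤ 11`,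
`40.6 ≤ 42`), hence `smallSol_on_patch` (`|x| < 1/64`) and `logSol_on_patch` (`0 < |x| < 1/512`, `ℓ = Real.log`, both
sides): `ψ_s` and `ψ_L = (14/5)·log|x|·ψ_s + η` solve the local tearing equation `x ψ″ + p ψ′ + q ψ = 0` of the instance
with the stated derivative functions. This is the Frobenius PATCH of the `Δ′` certificate as a kernel fact with explicit
radius; remaining: validated outer solves to `x = ∓1/1024` (kit), matchings, uniqueness, `Tearing.isDeltaPrime_of_logBranch`.
[instance data]
-/

noncomputable section

open Finset Literature.Analysis.ODE

namespace Summit.Ventures.FusionMHD.Models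

namespace TearingFRS1

/-! ### Sharp-radius bounds by the jet lemma -/

/-- `c = scalarLogC qc = 19/5`. [instance data] -/
theorem c_eq : scalarLogC qc = 19 / 5 := by
  rw [scalarLogC, qc_val_0]; norm_num

/-- THE JET of the small solution: `‖sₙ‖ ≤ 1 · 64ⁿ` for `n < 11`. [instance data] -/
theorem small_jet : ∀ n : ℕ, n < 11 →
    ‖frobeniusCoeff Msys (fun _ => 0) Rsys ((0 : ℝ), (1 : ℝ)) n‖ ≤ 1 * (64 : ℝ) ^ n := by
  intro n hn
  interval_cases n
  · rw [small_val_0]; simp only [Prod.norm_mk, Real.norm_eq_abs]; norm_num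
  · rw [small_val_1]; simp only [Prod.norm_mk, Real.norm_eq_abs]; norm_num
  · rw [small_val_2]; simp only [Prod.norm_mk, Real.norm_eq_abs]; norm_num
  · rw [small_val_3]; simp only [Prod.norm_mk, Real.norm_eq_abs]; norm_num
  · rw [small_val_4]; simp only [Prod.norm_mk, Real.norm_eq_abs]; norm_num
  · rw [small_val_5]; simp only [Prod.norm_mk, Real.norm_eq_abs]; norm_num
  · rw [small_val_6]; simp only [Prod.norm_mk, Real.norm_eq_abs]; norm_num
  · rw [small_val_7]; simp only [Prod.norm_mk, Real.norm_eq_abs]; norm_num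
  · rw [small_val_8]; simp only [Prod.norm_mk, Real.norm_eq_abs]; norm_num
  · rw [small_val_9]; simp only [Prod.norm_mk, Real.norm_eq_abs]; norm_num
  · rw [small_val_10]; simp only [Prod.norm_mk, Real.norm_eq_abs]; norm_num

/-- **ALL coefficients of the small solution**: `‖sₙ‖ ≤ 64ⁿ` (jet lemma, `μ = 64 > a = 8`, threshold
`c K' a/(μ − a) = 10.71… ≤ 11`). [instance data] -/
theorem small_coeff_bound (n : ℕ) :
    ‖frobeniusCoeff Msys (fun _ => 0) Rsys ((0 : ℝ), (1 : ℝ)) n‖ ≤ 1 * (64 : ℝ) ^ n := by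
  have hD := isScalarLogData.small
  refine norm_frobeniusCoeff_le_of_jet (N := 11) hD.a_nonneg hD.K_nonneg hD.G_nonneg hD.c_nonneg hD.norm_M_le
    hD.norm_g_le hD.norm_R_le (by norm_num) (by simp [Prod.norm_mk]) small_jet ?_ n
  rw [c_eq]; norm_num

/-- Frobenius data of the regular part with rate `64` (the rate of the small-solution bound) and `G = 14/5`.
[instance data] -/
theorem regData : IsFrobeniusData Msys (logBranchInhom Msys Rsys ((0 : ℝ), (1 : ℝ)) (14 / 5 : ℝ)) Rsys
    ((1 : ℝ), (14 / 5 : ℝ)) 64 (2 * (49 / 5) + 8⁻¹) (14 / 5) (scalarLogC qc) := by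
  have hD := isScalarLogData.small
  exact
  { a_nonneg := by norm_num
    K_nonneg := by norm_num
    G_nonneg := by norm_num
    c_nonneg := hD.c_nonneg
    norm_M_le := fun k hk => (hD.norm_M_le k hk).trans
      (mul_le_mul_of_nonneg_left (pow_le_pow_left₀ (by norm_num) (by norm_num) k) (by norm_num))
    norm_g_le := fun k _ => by
      rw [inhom_val, norm_neg, norm_smul]
      have h := small_coeff_bound k
      have : ‖(14 / 5 : ℝ)‖ = 14 / 5 := by norm_num
      rw [this]
      nlinarith [norm_nonneg (frobeniusCoeff Msys (fun _ => 0) Rsys ((0 : ℝ), (1 : ℝ)) k)]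
    rightInverse := hD.rightInverse
    norm_R_le := hD.norm_R_le
    compat := by
      rw [logBranchInhom_zero]
      ext <;> norm_num [Msys, scalarSysM_apply, pc_val_0, qc_val_0] }

/-- THE JET of the regular part: `‖wₙ‖ ≤ (14/5) · 512ⁿ` for `n < 15`. [instance data] -/
theorem reg_jet : ∀ n : ℕ, n < 15 →
    ‖frobeniusCoeff Msys (logBranchInhom Msys Rsys ((0 : ℝ), (1 : ℝ)) (14 / 5 : ℝ)) Rsys
      ((1 : ℝ), (14 / 5 : ℝ)) n‖ ≤ 14 / 5 * (512 : ℝ) ^ n := by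
  intro n hn
  interval_cases n
  · rw [reg_val_0]; simp only [Prod.norm_mk, Real.norm_eq_abs]; norm_num
  · rw [reg_val_1]; simp only [Prod.norm_mk, Real.norm_eq_abs]; norm_num
  · rw [reg_val_2]; simp only [Prod.norm_mk, Real.norm_eq_abs]; norm_num
  · rw [reg_val_3]; simp only [Prod.norm_mk, Real.norm_eq_abs]; norm_num
  · rw [reg_val_4]; simp only [Prod.norm_mk, Real.norm_eq_abs]; norm_num
  · rw [reg_val_5]; simp only [Prod.norm_mk, Real.norm_eq_abs]; norm_num
  · rw [reg_val_6]; simp only [Prod.norm_mk, Real.norm_eq_abs]; norm_num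
  · rw [reg_val_7]; simp only [Prod.norm_mk, Real.norm_eq_abs]; norm_num
  · rw [reg_val_8]; simp only [Prod.norm_mk, Real.norm_eq_abs]; norm_num
  · rw [reg_val_9]; simp only [Prod.norm_mk, Real.norm_eq_abs]; norm_num
  · rw [reg_val_10]; simp only [Prod.norm_mk, Real.norm_eq_abs]; norm_num
  · rw [reg_val_11]; simp only [Prod.norm_mk, Real.norm_eq_abs]; norm_num
  · rw [reg_val_12]; simp only [Prod.norm_mk, Real.norm_eq_abs]; norm_num
  · rw [reg_val_13]; simp only [Prod.norm_mk, Real.norm_eq_abs]; norm_num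
  · rw [reg_val_14]; simp only [Prod.norm_mk, Real.norm_eq_abs]; norm_num

/-- **ALL coefficients of the regular part**: `‖wₙ‖ ≤ (14/5)·512ⁿ` (jet lemma, `μ = 512 > a = 64`, threshold
`c (K' B a/(μ−a) + G) = 40.6… ≤ 15 · 14/5 = 42`). [instance data] -/
theorem reg_coeff_bound (n : ℕ) :
    ‖frobeniusCoeff Msys (logBranchInhom Msys Rsys ((0 : ℝ), (1 : ℝ)) (14 / 5 : ℝ)) Rsys
      ((1 : ℝ), (14 / 5 : ℝ)) n‖ ≤ 14 / 5 * (512 : ℝ) ^ n := by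
  have hD := regData
  refine norm_frobeniusCoeff_le_of_jet (N := 15) hD.a_nonneg hD.K_nonneg hD.G_nonneg hD.c_nonneg hD.norm_M_le
    hD.norm_g_le hD.norm_R_le (by norm_num) (by simp [Prod.norm_mk]; norm_num) reg_jet ?_ n
  rw [c_eq]; norm_num

/-! ### The two local solutions on the patch, both sides of the surface -/

/-- **SMALL SOLUTION ON THE PATCH.** For `|x| < 1/64` (inside `ρ₀ = 1/8` and the disc of the `64`-bound): `(ψ_s, ψ_s′)` is
differentiable, `ψ_s′` is the derivative of `ψ_s` (`x ≠ 0`), and `x ψ_s″ + p ψ_s′ + q ψ_s = 0`. [instance data] -/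
theorem smallSol_on_patch {x : ℝ} (hx : |x| < 1 / 64) :
    DifferentiableAt ℝ (scalarSmallSol pc qc) x ∧
      (x ≠ 0 → HasDerivAt (fun z => (scalarSmallSol pc qc z).1) ((scalarSmallSol pc qc x).2) x) ∧
      HasDerivAt (fun z => (scalarSmallSol pc qc z).2) ((deriv (scalarSmallSol pc qc) x).2) x ∧
      x * (deriv (scalarSmallSol pc qc) x).2 + p x * (scalarSmallSol pc qc x).2
        + q x * (scalarSmallSol pc qc x).1 = 0 := by
  have hxn : ‖x‖ < 1 / 8 := by rw [Real.norm_eq_abs]; linarith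
  have hx64 : (64 : ℝ) * ‖x‖ < 1 := by rw [Real.norm_eq_abs]; linarith
  exact isScalarLogData.smallSol_of_bound small_coeff_bound (by norm_num) hxn hx64

/-- **LOGARITHMIC BRANCH ON THE PATCH, BOTH SIDES.** For `0 < |x| < 1/512`, with `ℓ = Real.log` (`= log|x|`):
`ψ_L = κ log|x| ψ_s + η` (`κ = 14/5`, `(η, ζ)` the regular part through `(1, κ)`) has derivative `ψ_L′ = κ log|x| ψ_s′ + ζ`
at `x`, `ψ_L′` is differentiable at `x`, and `x ψ_L″ + p ψ_L′ + q ψ_L = 0`. This is the kernel form of the Frobenius PATCH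
of the `Δ′` certificate (to be matched at `x = ∓1/1024` against the validated outer solves). [instance data] -/
theorem logSol_on_patch {x : ℝ} (hx : |x| < 1 / 512) (hx0 : x ≠ 0) :
    HasDerivAt (fun z => (scalarLogSol pc qc 1 (14 / 5) Real.log z).1) ((scalarLogSol pc qc 1 (14 / 5) Real.log x).2) x ∧
      HasDerivAt (fun z => (scalarLogSol pc qc 1 (14 / 5) Real.log z).2)
        ((deriv (scalarLogSol pc qc 1 (14 / 5) Real.log) x).2) x ∧
      x * (deriv (scalarLogSol pc qc 1 (14 / 5) Real.log) x).2 + p x * (scalarLogSol pc qc 1 (14 / 5) Real.log x).2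
        + q x * (scalarLogSol pc qc 1 (14 / 5) Real.log x).1 = 0 := by
  have hxn : ‖x‖ < 1 / 8 := by rw [Real.norm_eq_abs]; linarith
  have hx512 : (512 : ℝ) * ‖x‖ < 1 := by rw [Real.norm_eq_abs]; linarith
  have hs : ∀ n, ‖frobeniusCoeff (scalarSysM pc qc) (fun _ => 0) (scalarSysR pc qc) ((0 : ℝ), (1 : ℝ)) n‖
      ≤ 1 * (512 : ℝ) ^ n := fun n =>
    (small_coeff_bound n).trans (mul_le_mul_of_nonneg_left (pow_le_pow_left₀ (by norm_num) (by norm_num) n)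
      (by norm_num))
  have hk : -(qc 0) * (1 : ℝ) = 14 / 5 := kappa_eq
  have hw : ∀ n, ‖frobeniusCoeff (scalarSysM pc qc)
      (logBranchInhom (scalarSysM pc qc) (scalarSysR pc qc) ((0 : ℝ), (1 : ℝ)) (-(qc 0) * 1))
      (scalarSysR pc qc) ((1 : ℝ), (14 / 5 : ℝ)) n‖ ≤ 14 / 5 * (512 : ℝ) ^ n := by
    rw [hk]; exact reg_coeff_bound
  exact isScalarLogData.logSol_of_bound 1 (14 / 5) hs hw (by norm_num) hxn hx512 hx0 (Real.hasDerivAt_log hx0)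

end TearingFRS1

end Summit.Ventures.FusionMHD.Models

end
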